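import Literature.MathematicalPhysics.QuantumFieldTheory.Balaban1983to89.B9Eq3136HstarJAtPinsLetterFamily

/-!
# `Balaban1983to89.B9Eq3136HstarJAtPinsLetterFamilyPt` — [B9] p. 422, the sentence between (3.136) and (3.137) *«From the regularity condition (3.36) and the
# inequality (3.133) we have the estimate |(H\*J)(b)| ≦ O(1)Mα₀(Lʲη)⁻³ for b ∈ Λ_j»* AT THE PINS, FOR AN ARBITRARY LETTER FAMILY `O` — THE POINTWISE FACE:
# the transpose schema (3.133) and the regularity datum (3.36) asked AT ONE MEMBER AND ONE CONFIGURATION, the threshold member-uniform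

T. Bałaban, *Propagators for lattice gauge theories in a background field*, Commun. Math. Phys. **99** (1985) 389–434 [`Balaban1985BackgroundPropagators`, "B9"]:
p. 422 (the sentence between (3.136) and (3.137)), (3.133) p. 422, (3.36) p. 396, p. 398 (the scale transfer); [4] = T. Bałaban, *Propagators and renormalization
transformations for lattice gauge theories. II*, Commun. Math. Phys. **96** (1984) 223–250 [`Balaban1984PropagatorsII`]: (2.51) p. 232, Lemma 2.1 (2.60)–(2.61)
pp. 233–234.

statement-level companion of published sources with citation tags; every declaration here is a theorem; nothing here is a claim about the
Yang–Mills mass gap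

WHY THIS FILE (cell `pub-ymgap`, seat `dag-n06-l` g41, 2026-08-31; sibling of seat dag-n08-d's `B9Eq3136HstarJAtPinsLetterFamily` (621 l., not appended to)).
§2 of that file, ✓`norm_trAdjY_JY_le_of_transpose_schemas_wR`, asks its two analytic inputs — the weighted transpose schema `hOT` ((3.133)) and r06's bond-local
regularity `hreg` ((3.36)) — as ROWS OVER THE WHOLE MEMBER FAMILY `∀ x : MemberY …` on a regime `(bg9YR … R₁ R₂ x).Reg335 ∩ Reg336`, although its proof reads
both only at the member, rate and configuration of the conclusion.  THIS FILE states the same estimate with the two inputs asked AT THE POINT `(x, α₀, U)`: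
`norm_trAdjY_JY_le_of_transpose_schemas_wR_pt` — above ONE member-uniform threshold `MH` (from the member facts only: the p. 398 transfer at `((1−2α)δ₀, α_F)` and
[4] (2.61) at `ρ_R`), for every member `x` with `MH, M ≤ M_x`, every `0 < α₀` with `M_xα₀ ≤ a` and EVERY configuration `U` (no regime is read here — the regime
was only the domain on which the caller holds the two inputs): IF the transpose pair + its [4]-(2.51) majorant hold at `(x, U)` and the fine bonds are regular at
`(x, α₀, U)`, THEN `‖(O(U)†J(U))(c)‖ ≤ t_{HJ}·(M_xα₀)·(W_T x c·((Lʲη)_c³)⁻¹)` for every coarse bond `c`.  The family-wide §2 is the instance «feed `hOT x …`,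
`hreg x …`»; a caller holding the inputs on a SUB-FAMILY only (IR-N06-SECTION-2 road R1, ★★★ director-ym №524 (3): the N06 producer cone re-keyed along
`f : J → MemberY …`, dag-n06-d `R1-JTWIN-SPEC.md`) feeds them at `f j` — which is why this face exists (the J-twin of N06's (3.137) leg
`…N06Delta2AtPinsPhysPQ` reads it; BY-NAME staging, dag-n06-l g41).
PROOF: §2's proof VERBATIM with the two applications `hOT x …` ∕ `hreg x …` replaced by the point hypotheses (generator over the tree bytes; nothing re-derived).
HONEST SCOPE.  Kernel bookkeeping BY NAME over n06-w8's `B9Eq3136HstarJBound` and the p21∕n06-k member facts, exactly as §2; (3.133) and (3.36) stay HYPOTHESES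
(now pointwise); nothing of [B9] ∕ [4] asserted; count-neutral; N06 ∕ N08 NOT discharged; one finite 𝕋^{d+1} programme — nothing continuum ∕ ℝ⁴ ∕ OS ∕ mass
gap ∕ Clay.  No `sorry`, no `def`, no `instance`, no `notation`.  Relative not restated: §2 itself (this is its pointwise strengthening, not a copy).
-/

noncomputable section

namespace Literature.MathematicalPhysics.QuantumFieldTheory.Balaban1983to89.B9Eq3136HstarJAtPinsLetterFamilyPt

open Node00 (CfgY FBondY IBondY SiteParY BondParY SiteOpY BondOpY GpY GpPhysY parSymY parBY trDualMatY trAdjY JY Stage3Params ResY etaBY etaS etaDY deltaY)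
open B6KLevelCensusIndexV1 (KIdx)
open B6Ineq2142KLevelV1 (β lvl lvl_le beta_level)
open B9Thm34Ext (toB6)
open B6RandomWalkHom (HasMajorantHom)
open B9Thm37Glue (IsTransposePair)
open B9RWSumsDefinitePins (PinPrims)
open B9RWSums347DefiniteFaces (lemma21Pack_geo9Y)
open B9RowSum261DefiniteFaces (rowConst261 rowConst261_nonneg rowConst261_spec_of_rowSum261)
open B9RWSums346Schur (scaleTransfer_len_rpow)
open B9PinMembersKLevelV1 (MemberY geo9Y bg9Y)
open B9GeoLemma21KLevelV1 (geo9Y_len_pos rowSum261_geo9Y)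
open B9GeoNormsKLevelV1 (geo9K_dist_nonneg)
open B7Prop2SpecialUnitary (specialUnitaryUnits)
open B9CoReadingCoords (XBK)
open B9CoReadingCoordsH (XHK HcoK)
open B9CoReadingCoordsTranspose (TrIdx trBasis)
open B9Thm39ReadingCoords (cR39 basisBound39 coordBound39)
open Node00.OpsYSectDCoords (cR39_trBasis_pos)
open B9Eq336CurrentBound (RegularAt)
open B9BackgroundsKLevelV1 (shiftsV1)
open B6GlobalChartV1 (PV)
open B9Eq3136HstarJBound (norm_trAdjY_JY_le_of_cols_regularAt sum_fiber_kernel_le_of_transposePair colConst_eq norm_apply_deltaY_le_sum_basis)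
open B9Eq3136HstarJAtPinsLetterFamily (etaBY_le_geo9Y_len)
open scoped Matrix.Norms.L2Operator

variable {N : ℕ} {θ : Stage3Params} {Mstar : ℕ}
variable [NeZero N]
variable [∀ x : MemberY θ.d₆ θ.ℓ₆ θ.hd' θ.hL' θ.b₀ θ.b₁ Mstar, Fintype (geo9Y x).Site]

/-- ★★ **THE `(H\*J)` LETTER AT THE PINS FOR AN ARBITRARY LETTER FAMILY `O` — POINTWISE FACE** (the sibling file's §2
`norm_trAdjY_JY_le_of_transpose_schemas_wR` with its two analytic rows asked AT THE POINT): there is ONE member-uniform threshold `MH` such that for every member `x`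
with `MH ≤ M_x`, `M ≤ M_x`, every `0 < α₀` with `M_xα₀ ≤ a`, every configuration `U` — IF the counting-transpose `𝔗 x U` of the model `HcoK … (O x) U` is a transpose
pair with the [4]-(2.51) majorant `B_T·W_T(c)·e^{−δ_T d}` from the fine carrier (blocks `bI x`) to the coarse one AT `(x, U)`, and every fine bond is regular at the pin
scale with constant `c_J·(M_xα₀)` AT `(x, α₀, U)` — THEN `‖(O(U)†J(U))(c)‖ ≤ t_{HJ}·(M_xα₀)·(W_T x c·((Lʲη)_c³)⁻¹)` for every coarse bond `c`; direction-blind pin `hbI0`,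
budget `α_F(1−2α)δ₀ + ρ_R ≤ δ_T`, ONE constant `t_{HJ} ≥ N𝔟²·(10⁴(d+1)c_J)·((d+1)·#κ·B_T)·(ℓ+1)³·rowConst261 geo9Y ρ_R`, `c_J·a ≤ 1`.  No regime and no class fact is read.
[cite: Balaban1985BackgroundPropagators, p.422 (the sentence between (3.136) and (3.137)), (3.133) p.422, (3.36) p.396, p.398; Balaban1984PropagatorsII, (2.51) p.232, Lemma 2.1 (2.60)–(2.61) pp.233–234] -/
theorem norm_trAdjY_JY_le_of_transpose_schemas_wR_pt (q : PinPrims) (hq : q.OK) (H : MemberY θ.d₆ θ.ℓ₆ θ.hd' θ.hL' θ.b₀ θ.b₁ Mstar → Prop)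
    (O : ∀ x : MemberY θ.d₆ θ.ℓ₆ θ.hd' θ.hL' θ.b₀ θ.b₁ Mstar,
      CfgY (Matrix (Fin N) (Fin N) ℂ) x.toKIdx → (IBondY x.toKIdx → Matrix (Fin N) (Fin N) ℂ) →ₗ[ℂ] (FBondY x.toKIdx → Matrix (Fin N) (Fin N) ℂ))
    (bI : ∀ x : MemberY θ.d₆ θ.ℓ₆ θ.hd' θ.hL' θ.b₀ θ.b₁ Mstar, FBondY x.toKIdx → IBondY x.toKIdx)
    (hbI0 : ∀ (x : MemberY θ.d₆ θ.ℓ₆ θ.hd' θ.hL' θ.b₀ θ.b₁ Mstar) (f : FBondY x.toKIdx), bI x f = bI x ⟨f.src, 0⟩)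
    (𝔗 : ∀ x : MemberY θ.d₆ θ.ℓ₆ θ.hd' θ.hL' θ.b₀ θ.b₁ Mstar, (bg9Y (Matrix (Fin N) (Fin N) ℂ) (specialUnitaryUnits (Fin N)) x).Cfg →
      (XBK (TrIdx N) x.toKIdx → ℝ) →ₗ[ℝ] (XHK (TrIdx N) x.toKIdx → ℝ))
    (WT : ∀ x : MemberY θ.d₆ θ.ℓ₆ θ.hd' θ.hL' θ.b₀ θ.b₁ Mstar, IBondY x.toKIdx → ℝ) (hWT : ∀ x c, 0 ≤ WT x c)
    (cJ BT δT ρR tHJ M a : ℝ) (hcJ : 0 ≤ cJ) (hBT : 0 ≤ BT) (hρR : 0 < ρR) (hM : 0 < M) (ha1 : cJ * a ≤ 1)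
    (hδT : q.αF * ((1 - 2 * q.α) * q.δ₀) + ρR ≤ δT)
    (htHJ : N * basisBound39 (trBasis N) ^ 2 * (10 ^ 4 * ((θ.d₆ : ℝ) + 1) * cJ) * (((θ.d₆ : ℝ) + 1) * Fintype.card (TrIdx N) * BT) *
      ((((θ.ℓ₆ + 1 : ℕ) : ℝ) ^ 3) * rowConst261 (geo9Y (d := θ.d₆) (ℓ := θ.ℓ₆) (hd := θ.hd') (hL := θ.hL') (b₀ := θ.b₀) (b₁ := θ.b₁) (Mstar := Mstar)) ρR) ≤ tHJ)
:
    ∃ MH : ℝ, ∀ x : MemberY θ.d₆ θ.ℓ₆ θ.hd' θ.hL' θ.b₀ θ.b₁ Mstar, MH ≤ (geo9Y x).M → M ≤ (geo9Y x).M → ∀ α₀ : ℝ, 0 < α₀ → (geo9Y x).M * α₀ ≤ a →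
      ∀ U : (bg9Y (Matrix (Fin N) (Fin N) ℂ) (specialUnitaryUnits (Fin N)) x).Cfg,
          (IsTransposePair (HcoK x.toKIdx (trBasis N) (bg9Y (Matrix (Fin N) (Fin N) ℂ) (specialUnitaryUnits (Fin N)) x) (fun U => U) (O x) U) (𝔗 x U) ∧
            HasMajorantHom (g := toB6 (geo9Y x) 1 (H x)) (fun p : XBK (TrIdx N) x.toKIdx => bI x p.1) (fun p : XHK (TrIdx N) x.toKIdx => p.1) (𝔗 x U)
              (fun c y' => BT * WT x c * Real.exp (-(δT * (geo9Y x).dist c y')))) →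
          (∀ μ s, RegularAt (shiftsV1 (PV θ.d₆ θ.ℓ₆ x.toKIdx.m x.toKIdx.K θ.hd' θ.hL')) U (etaBY x.toKIdx)
            (cJ * ((geo9Y x).M * α₀)) ((geo9Y x).len (bI x ⟨s, 0⟩)) μ s) →
          ∀ c : IBondY x.toKIdx,
            ‖trAdjY (trDualMatY N) (O x U) (JY x.toKIdx U) c‖ ≤ tHJ * ((geo9Y x).M * α₀) * (WT x c * ((geo9Y x).len c ^ 3)⁻¹) := by
  -- member facts: the p. 398 transfer at ((1 − 2α)δ₀, α_F) and [4] (2.61) at the rate ρ_R, above ONE threshold each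
  obtain ⟨Mth, -, hfacts, -⟩ :=
    lemma21Pack_geo9Y (d := θ.d₆) (ℓ := θ.ℓ₆) (hd := θ.hd') (hL := θ.hL') (b₀ := θ.b₀) (b₁ := θ.b₁) (Mstar := Mstar) H hq.α_pos hq.α_lt
      hq.δ₀_pos hq.αF_pos (by linarith only [hq.αF_lt])
  obtain ⟨MLσ, hrowc⟩ := rowConst261_spec_of_rowSum261
    (rowSum261_geo9Y (d := θ.d₆) (ℓ := θ.ℓ₆) (hd := θ.hd') (hL := θ.hL') (b₀ := θ.b₀) (b₁ := θ.b₁) (Mstar := Mstar)) hρR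
  have hN : 0 < N := Nat.pos_of_ne_zero (NeZero.ne N)
  have hc0 : 0 < cR39 (trBasis N) := cR39_trBasis_pos hN
  refine ⟨max Mth MLσ, fun x hMx hMM α₀ hα ha U hOTx hregx c => ?_⟩
  have hF := hfacts x ((le_max_left _ _).trans hMx)
  have hθ : 0 ≤ (geo9Y x).M * α₀ := mul_nonneg (hM.le.trans hMM) hα.le
  -- print's `O(1)Mα₀ ≤ 1`
  have hC0 : 0 ≤ cJ * ((geo9Y x).M * α₀) := mul_nonneg hcJ hθ
  have hC1 : cJ * ((geo9Y x).M * α₀) ≤ 1 := (mul_le_mul_of_nonneg_left ha hcJ).trans ha1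
  -- p. 398 transfer of `(Lʲη)⁻³` at constant `L³ ≤ (ℓ+1)³`
  have hL1 : 1 ≤ (geo9Y x).L := hF.one_le_L
  have hLle : (geo9Y x).L ^ |(-3 : ℝ)| ≤ ((θ.ℓ₆ + 1 : ℕ) : ℝ) ^ 3 := by
    rw [show |(-3 : ℝ)| = (3 : ℕ) by norm_num, Real.rpow_natCast]
    exact pow_le_pow_left₀ (zero_le_one.trans hL1) hF.L_le 3
  have htr : ∀ y y' : (geo9Y x).Site, Real.exp (-(q.αF * ((1 - 2 * q.α) * q.δ₀) * (geo9Y x).dist y y')) * ((geo9Y x).len y' ^ 3)⁻¹ ≤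
      ((θ.ℓ₆ + 1 : ℕ) : ℝ) ^ 3 * ((geo9Y x).len y ^ 3)⁻¹ := by
    intro y y'
    have hst := scaleTransfer_len_rpow hF (-3) (by norm_num) y y'
    have hy := geo9Y_len_pos x y
    have hy' := geo9Y_len_pos x y'
    have e1 : ((geo9Y x).len y' ^ 3)⁻¹ = (geo9Y x).len y' ^ (-3 : ℝ) := by
      rw [show (-3 : ℝ) = -((3 : ℕ) : ℝ) by norm_num, Real.rpow_neg hy'.le, Real.rpow_natCast]
    have e2 : ((geo9Y x).len y ^ 3)⁻¹ = (geo9Y x).len y ^ (-3 : ℝ) := by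
      rw [show (-3 : ℝ) = -((3 : ℕ) : ℝ) by norm_num, Real.rpow_neg hy.le, Real.rpow_natCast]
    rw [e1, e2]
    exact hst.trans (mul_le_mul_of_nonneg_right hLle (Real.rpow_nonneg hy.le _))
  -- [4] (2.61) row sum at the rate ρ_R
  have hR : ∑ y' : (geo9Y x).Site, Real.exp (-(ρR * (geo9Y x).dist c y')) ≤
      rowConst261 (geo9Y (d := θ.d₆) (ℓ := θ.ℓ₆) (hd := θ.hd') (hL := θ.hL') (b₀ := θ.b₀) (b₁ := θ.b₁) (Mstar := Mstar)) ρR := by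
    exact hrowc x ((le_max_right _ _).trans hMx) c
  obtain ⟨hT, hK'⟩ := hOTx
  -- the pointwise kernel letter of `O(U)` from the basis directions (F7 §2), then F7 §5 at `B_H := (d+1)·#κ·B_T·W_T(c)`
  have hKH0 : ∀ z : FBondY x.toKIdx, 0 ≤ coordBound39 (trBasis N) * ∑ k', ‖O x U (deltaY c (trBasis N k')) z‖ := fun z =>
    mul_nonneg (norm_nonneg _) (Finset.sum_nonneg fun _ _ => norm_nonneg _)
  have hH : ∀ (a : Matrix (Fin N) (Fin N) ℂ) (z : FBondY x.toKIdx),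
      ‖O x U (deltaY c a) z‖ ≤ (coordBound39 (trBasis N) * ∑ k', ‖O x U (deltaY c (trBasis N k')) z‖) * ‖a‖ :=
    fun a z => norm_apply_deltaY_le_sum_basis x.toKIdx (trBasis N) (O x) U a c z
  have hmain := norm_trAdjY_JY_le_of_cols_regularAt x.toKIdx (g := geo9Y x) (O x U) (bI x) (hbI0 x) (fun c => c) (etaBY_le_geo9Y_len x)
    hC0 hC1 U hregx c (BH := ((θ.d₆ : ℝ) + 1) * Fintype.card (TrIdx N) * BT * WT x c) (δH := δT) hKH0
    (mul_nonneg (mul_nonneg (mul_nonneg (by positivity) (Nat.cast_nonneg _)) hBT) (hWT x c)) hH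
    (fun y' => by
      -- the column-block letter from the WEIGHTED transpose majorant: F7 §2 at the kernel `B_T·W_T(c)·e^{−δ_T d}` (the weight is constant in the
      -- summation variable), constant reduced by `colConst_eq`
      have h := sum_fiber_kernel_le_of_transposePair (R₀ := 1) (H₀ := H x) x.toKIdx (trBasis N)
        (bg9Y (Matrix (Fin N) (Fin N) ℂ) (specialUnitaryUnits (Fin N)) x) (fun U => U) (O x) (g := geo9Y x) (bI x) (fun c => c) U hc0 hT
        (fun a _ => mul_nonneg (mul_nonneg hBT (hWT x a)) (Real.exp_nonneg _)) hK' c y'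
      rw [colConst_eq (trBasis N) hc0] at h
      refine h.trans (le_of_eq ?_)
      ring)
    (by positivity) hδT (geo9K_dist_nonneg x.toKIdx) htr hR
  have hw : 0 ≤ WT x c * ((geo9Y x).len c ^ 3)⁻¹ := mul_nonneg (hWT x c) (inv_nonneg.mpr (pow_nonneg (geo9Y_len_pos x c).le 3))
  calc _ ≤ _ := hmain
    _ = (N * basisBound39 (trBasis N) ^ 2 * (10 ^ 4 * ((θ.d₆ : ℝ) + 1) * cJ) * (((θ.d₆ : ℝ) + 1) * Fintype.card (TrIdx N) * BT) *
          ((((θ.ℓ₆ + 1 : ℕ) : ℝ) ^ 3) *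
            rowConst261 (geo9Y (d := θ.d₆) (ℓ := θ.ℓ₆) (hd := θ.hd') (hL := θ.hL') (b₀ := θ.b₀) (b₁ := θ.b₁) (Mstar := Mstar)) ρR)) *
          ((geo9Y x).M * α₀) * (WT x c * ((geo9Y x).len c ^ 3)⁻¹) := by ring
    _ ≤ tHJ * ((geo9Y x).M * α₀) * (WT x c * ((geo9Y x).len c ^ 3)⁻¹) := mul_le_mul_of_nonneg_right (mul_le_mul_of_nonneg_right htHJ hθ) hw

/-! ## §3 The print-unit face: `η^{d+1}·‖(O(U)†J(U))(c)‖ ≤ t_{HJ}·a·w₁`, UNIFORM in the coarse bond (the currency of the doors' 𝒥-row (b†)) -/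


end Literature.MathematicalPhysics.QuantumFieldTheory.Balaban1983to89.B9Eq3136HstarJAtPinsLetterFamilyPt

end
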